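import Summits.CriticalPhenomena.PercolationContinuityZ3.Theorems.Transplant.SkelNegBParamsSlotsST
import Summits.CriticalPhenomena.PercolationContinuityZ3.Theorems.Transplant.SkelPhiFatRadius
import Summits.CriticalPhenomena.PercolationContinuityZ3.Theorems.Transplant.SkelConcRootRadii
import HarnessLib

/-!
# N1 params, chain of record `NegB`, part SlotsSU: THE FIBRE BLOCK OF RECORD, THIRD VERSION `NegB.SU (ex mx : GSlot) : SSlot` — `ψM := ψπ := fatRadius Φ.frame hC D.k`
# (the seed's fat radius) instead of `0`, everything else as part SlotsST's `ST`; and THE ROOT RADIUS OF RECORD `NegB.Rπ … Sv q := E₀ (Sv … q) − 1` with the four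
# root-radii facts and every `Rπ`-inequality of p3-g9's `rootOblTWAt_negBS_x/_y` reduced to floors on `ex`

WHY (located (L-R1), lane INBOX 2026-08-21T19:03Z): the root residue needs `Rex κ Φ m q (fatRadius k) ≤ Rπ − r₀` with `Rπ + 1 ≤ rQ 0 0 = E₀ ⊔ …`; the only
`q`-dependent term below `E₀` is `L_A`'s `S.Rex (2·ψM)`, and `Rex` is monotone in the depth, so the inequality closes iff `fatRadius k ≤ 2·ψM` — hence `ψM := ψπ`
((F)/(C) read no `ψM`-fact; all their floors are `≥`-facts, re-served here as `…_U`).  The planar diameter `m` must be the fibre diameter `mR … (mx …)` (part SlotsS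
`fine_diam_le_mR`), not `2·Rπ`.

builds on p205010 (kernel theorem, internal audit signed; external expert review pending) — nothing in this file uses p205010; NOTHING is claimed about
the node `SamePDropOfSkeletonNeg₁` (OPEN).
Lane `prim-bschramm-*`, seat `prim-bschramm-stmt` (gen 14); helper file (`--supports stmt-CriticalPhenomena-4575 --as helper`); ledger HOME/prim-bschramm-stmt/NEG-PARAMS.md v0.13.
* §1 **`ψπ`** (`ψπ_eq`), **`SU`**, `SU_fields`, `SU_rmax_ge`; §2–§3 the ST facts verbatim at `SU`: `hgap20_U hgapc_U hgapR_U hgapL_U ex_le_Lp_U three_le_E₀_U hsch_U Rex_mono_U hR₁_U hRex_U hR₁_U_η`;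
* §4 **`E₀_SU_eq`**: `E₀ (SU …) = ex + Rex κ Φ mR q (2ψπ) + 69·rmax′ + 4·ψπ + 48`;
* §5 generic `Sv`: **`Rπ`**, `twelve_le_E₀`, `Rπ_succ`, **`hRQ_R hRB_R hRQ'_R hRM_R`** (`Rπ + 1 ≤ rQ 0 0 / rB 0 0 du / rQ 0 (0+du) / rM 0 (0+du)` of `schedOf … (Sv … q)`), `le_Rπ_of`
  (`X + 1 ≤ E₀ → X ≤ Rπ`);
* §6 at `SU`: `ex_le_Rπ` (`X + 1 ≤ ex → X ≤ Rπ`), **`fat_le_Rπ`**, **`Rex_fat_le_Rπ_sub`** (`r₀ + 1 ≤ ex → Rex κ Φ mR q (fatRadius k) ≤ Rπ − r₀` — p3's `hR₁b/hR₁r`).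
[cite: KozmaNitzan2024, §4 Theorem 6 (pp. 25–31), p. 28 ((32) at the root); Lemma 12 (p. 24)] [cite: MartineauTassion2017, §4.3]
-/

noncomputable section

open scoped Classical

namespace Summit.CriticalPhenomena.PercolationContinuityZ3.Theorems.Transplant

namespace PlanarSkeletonNeg

namespace NegB

open MeasureTheory Literature.Probability.Percolation Literature.Probability.LatticeModels SimpleGraph
open Literature.Barriers.CriticalPhenomena (graphBall)
open SkelConc (Consts)
open BoxProdZ2 (ConcRadiiG Erad Frad nQ)
open Skelφ (oriφ trφ)
open Skelφ.StepI (DataN OutO)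
open Skel (excess)
open Neg

/-! ## §1 The seed's fat radius as the `ψM` field; the block -/

/-- **The seed's fat radius `ψπ := fatRadius Φ.frame hC D.k`** as a p-level number (`0` off `Φ.CylSubcritical p`). [cite: KozmaNitzan2024, §4 p. 16 (Lemma 9)] -/
def ψπ {V : Type} [Countable V] {G : SimpleGraph V} [G.LocallyFinite] (Φ : PlanarSkeletonNeg G) (p : unitInterval) (D : DataN V) : ℕ :=
  if h : Φ.CylSubcritical p then Skelφ.fatRadius Φ.frame h D.k else 0

/-- `ψπ = fatRadius Φ.frame hC D.k` under `hC`. [folklore] -/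
theorem ψπ_eq {V : Type} [Countable V] {G : SimpleGraph V} [G.LocallyFinite] (Φ : PlanarSkeletonNeg G) {p : unitInterval} (hC : Φ.CylSubcritical p) (D : DataN V) :
    ψπ Φ p D = Skelφ.fatRadius Φ.frame hC D.k := by
  unfold ψπ; rw [dif_pos hC]

/-- **THE FIBRE BLOCK OF RECORD (third version)**: `⟨max fcells.rmax (cOff+1), 1, 0, ψπ, 0, ex κ Φ t p D g f, NegB.Rex (mR … (mx …)) q⟩`.
[cite: KozmaNitzan2024, §4 Theorem 6 (pp. 25–31): the order of constants] -/
def SU (ex mx : GSlot) : SSlot := fun κ _ _ _ _ _ Φ t p D g f q =>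
  ⟨max (fcells κ Φ t p D g f).rmax (cOff κ Φ t p D g f + 1), 1, 0, ψπ Φ p D, 0, ex κ Φ t p D g f, Rex κ Φ (mR κ Φ t p D g f (mx κ Φ t p D g f)) q⟩

section Facts

variable (κ : Consts) {V : Type} [DecidableEq V] [Countable V] {G : SimpleGraph V} [G.LocallyFinite] (Φ : PlanarSkeletonNeg G) (t : V)
  (p : unitInterval) (D : DataN V) (g f : ℕ) (ex mx : GSlot) (q : unitInterval)

/-- The fields of `SU` (all `rfl`). [folklore] -/
theorem SU_fields : (SU ex mx κ Φ t p D g f q).rmax = max (fcells κ Φ t p D g f).rmax (cOff κ Φ t p D g f + 1) ∧ (SU ex mx κ Φ t p D g f q).u = 1 ∧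
    (SU ex mx κ Φ t p D g f q).M = 0 ∧ (SU ex mx κ Φ t p D g f q).ψM = ψπ Φ p D ∧ (SU ex mx κ Φ t p D g f q).ψtop = 0 ∧ (SU ex mx κ Φ t p D g f q).reachK = ex κ Φ t p D g f ∧
    (SU ex mx κ Φ t p D g f q).Rex = Rex κ Φ (mR κ Φ t p D g f (mx κ Φ t p D g f)) q :=
  ⟨rfl, rfl, rfl, rfl, rfl, rfl, rfl⟩

/-- `fcells.rmax ≤ rmax` and `cOff + 1 ≤ rmax`. [folklore] -/
theorem SU_rmax_ge : (fcells κ Φ t p D g f).rmax ≤ (SU ex mx κ Φ t p D g f q).rmax ∧ cOff κ Φ t p D g f + 1 ≤ (SU ex mx κ Φ t p D g f q).rmax :=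
  ⟨le_max_left _ _, le_max_right _ _⟩

/-! ## §2 The gap, `L′`, `E₀` at the value -/

/-- **`20·fcells.rmax ≤ gap ρ`** ((C)'s `hgap`, hp-8's `hgap20`). [folklore] -/
theorem hgap20_U (ρ : ℕ) : 20 * (fcells κ Φ t p D g f).rmax ≤ Skelφ.Prm.gap (SU ex mx κ Φ t p D g f q) ρ :=
  le_trans (Nat.mul_le_mul_left _ (SU_rmax_ge κ Φ t p D g f ex mx q).1) (Skelφ.Prm.twenty_rmax_le_gap _ ρ)

/-- **`cOff ≤ gap ρ`** ((C)'s `hgapc`/`hgapC` with `c := cOff`, hp-8's `hgapc`). [folklore] -/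
theorem hgapc_U (ρ : ℕ) : cOff κ Φ t p D g f ≤ Skelφ.Prm.gap (SU ex mx κ Φ t p D g f q) ρ := by
  have h1 := (SU_rmax_ge κ Φ t p D g f ex mx q).2
  have h2 := Skelφ.Prm.dG_le_gap (SU ex mx κ Φ t p D g f q) ρ
  exact le_trans (le_trans (le_trans (Nat.le_succ _) h1) (Nat.le_mul_of_pos_left _ (by norm_num))) h2

/-- **`cOff + 2L′ + Rex ρ + 2 ≤ gap ρ`** (hp-8's `hgapR` with `R₁ := Rex`; `gap ρ = 2L′ + 1 + Rex (ρ+1) + 100·rmax`, `Rex` monotone, `100·rmax ≥ 100(cOff+1)`). [folklore] -/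
theorem hgapR_U (ρ : ℕ) : cOff κ Φ t p D g f + 2 * Skelφ.Prm.Lp (SU ex mx κ Φ t p D g f q) + Rex κ Φ (mR κ Φ t p D g f (mx κ Φ t p D g f)) q ρ + 2 ≤
    Skelφ.Prm.gap (SU ex mx κ Φ t p D g f q) ρ := by
  rw [Skelφ.Prm.gap_eq]
  have h1 : cOff κ Φ t p D g f + 1 ≤ (SU ex mx κ Φ t p D g f q).rmax := (SU_rmax_ge κ Φ t p D g f ex mx q).2
  have h2 : Rex κ Φ (mR κ Φ t p D g f (mx κ Φ t p D g f)) q ρ ≤ (SU ex mx κ Φ t p D g f q).Rex (ρ + 1) := Rex_mono κ Φ _ q (Nat.le_succ ρ)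
  generalize (SU ex mx κ Φ t p D g f q).rmax = R at h1 ⊢
  generalize (SU ex mx κ Φ t p D g f q).Rex (ρ + 1) = X at h2 ⊢
  generalize Skelφ.Prm.Lp (SU ex mx κ Φ t p D g f q) = L
  omega

/-- `L′ ≤ gap ρ`. [folklore] -/
theorem hgapL_U (ρ : ℕ) : Skelφ.Prm.Lp (SU ex mx κ Φ t p D g f q) ≤ Skelφ.Prm.gap (SU ex mx κ Φ t p D g f q) ρ := Skelφ.Prm.hgapL _ ρ

/-- **The residual floor reaches `L′` and `E₀`**: `ex ≤ L′ ≤ E₀`. [folklore] -/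
theorem ex_le_Lp_U : ex κ Φ t p D g f ≤ Skelφ.Prm.Lp (SU ex mx κ Φ t p D g f q) ∧ Skelφ.Prm.Lp (SU ex mx κ Φ t p D g f q) ≤ Skelφ.Prm.E₀ (SU ex mx κ Φ t p D g f q) := by
  refine ⟨?_, Skelφ.Prm.Lp_le_E₀ _⟩
  have h := Skelφ.Prm.reachK_le_Lp (SU ex mx κ Φ t p D g f q)
  exact h

/-- `3 ≤ E₀` ((C)'s `hE₀`), indeed `45·rmax ≤ E₀` with `rmax ≥ 1`. [folklore] -/
theorem three_le_E₀_U : 3 ≤ Skelφ.Prm.E₀ (SU ex mx κ Φ t p D g f q) ∧ 45 * (fcells κ Φ t p D g f).rmax ≤ Skelφ.Prm.E₀ (SU ex mx κ Φ t p D g f q) := by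
  have h1 := Skelφ.Prm.planar_le_E₀ (SU ex mx κ Φ t p D g f q)
  have h2 := (SU_rmax_ge κ Φ t p D g f ex mx q).1
  have h3 : 1 ≤ (fcells κ Φ t p D g f).rmax := le_trans ((fcells κ Φ t p D g f).one_le_r 0) ((fcells κ Φ t p D g f).r_le_rmax 0)
  have h4 : 45 * (fcells κ Φ t p D g f).rmax ≤ Skelφ.Prm.E₀ (SU ex mx κ Φ t p D g f q) :=
    le_trans (le_trans (Nat.mul_le_mul_left 45 h2) (Nat.le_add_right _ _)) h1
  exact ⟨le_trans (le_trans (by norm_num : 3 ≤ 45 * 1) (Nat.mul_le_mul_left 45 h3)) h4, h4⟩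

/-- **`hsch`**: `Rex (E g' + 1) + L′ ≤ E (g'+1)` for `E := Erad gap 0 E₀` (D″'s `Prm.hsch`, `100·rmax` absorbed). [folklore] -/
theorem hsch_U (g' : ℕ) : Rex κ Φ (mR κ Φ t p D g f (mx κ Φ t p D g f)) q (Erad (Skelφ.Prm.gap (SU ex mx κ Φ t p D g f q)) (fun _ => 0) (Skelφ.Prm.E₀ (SU ex mx κ Φ t p D g f q)) g' + 1) +
      Skelφ.Prm.Lp (SU ex mx κ Φ t p D g f q) ≤ Erad (Skelφ.Prm.gap (SU ex mx κ Φ t p D g f q)) (fun _ => 0) (Skelφ.Prm.E₀ (SU ex mx κ Φ t p D g f q)) (g' + 1) := by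
  have h := Skelφ.Prm.hsch (SU ex mx κ Φ t p D g f q) g'
  exact le_trans (Nat.add_le_add_right (Nat.le_add_right _ _) _) h

/-- `Rex` at the value is monotone ((C)'s excess radius as a function of the entrance depth). [folklore] -/
theorem Rex_mono_U : Monotone (SU ex mx κ Φ t p D g f q).Rex := Rex_monotone κ Φ _ q

/-! ## §3 The excess at the value -/

/-- **`hR₁` at the value** ((F)/(R): depth `ρ+1`, any centre, either orientation, any `η' ≥ η`, planar diameter `mR`) — stated with the consumer's `[DecidableEq V]`
instance inside `Neg.η` (part Excess's `hR₁_at` carries the classical one; the two agree by `Subsingleton.elim`, which `convert` discharges). [folklore] -/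
theorem hR₁_U (hC : Φ.CylSubcritical q) (o : Bool) {η' : ℝ} (hη' : Neg.η κ Φ ≤ η') (c : V) :
    ∀ ρ R', (SU ex mx κ Φ t p D g f q).Rex ρ ≤ R' → ∀ (Rw : ℕ) (D' A' : Finset V), (∀ d ∈ D', d ∈ graphBall G c Rw) →
      (∀ d ∈ D', ∀ d' ∈ D', oriφ Φ.φ o d - oriφ Φ.φ o d' ∈ box 2 (mR κ Φ t p D g f (mx κ Φ t p D g f))) → A' ⊆ D' → (∀ a ∈ A', a ∈ graphBall G c (ρ + 1)) →
        (bondPercolation G q).real (excess G c R' D' A') ≤ η' := by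
  have hη'' : @Neg.η κ V (fun a b => Classical.propDecidable (a = b)) _ G _ Φ ≤ η' := by convert hη' using 2
  exact hR₁_at κ Φ (mR κ Φ t p D g f (mx κ Φ t p D g f)) hC o hη'' c

/-- **`hRex` at the value** ((C): depth `R₀'`), consumer's instance. [folklore] -/
theorem hRex_U (hC : Φ.CylSubcritical q) (o : Bool) {η' : ℝ} (hη' : Neg.η κ Φ ≤ η') (c : V) :
    ∀ R₀' R₁, (SU ex mx κ Φ t p D g f q).Rex R₀' ≤ R₁ → ∀ (Rw : ℕ) (D' A' : Finset V), (∀ d ∈ D', d ∈ graphBall G c Rw) →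
      (∀ d ∈ D', ∀ d' ∈ D', oriφ Φ.φ o d - oriφ Φ.φ o d' ∈ box 2 (mR κ Φ t p D g f (mx κ Φ t p D g f))) → A' ⊆ D' → (∀ a ∈ A', a ∈ graphBall G c R₀') →
        (bondPercolation G q).real (excess G c R₁ D' A') ≤ η' := by
  have hη'' : @Neg.η κ V (fun a b => Classical.propDecidable (a = b)) _ G _ Φ ≤ η' := by convert hη' using 2
  exact hRex_at κ Φ (mR κ Φ t p D g f (mx κ Φ t p D g f)) hC o hη'' c

/-- `η ≤ η` across instances: the consumer's `Neg.η`/`Neg.δkit` facts (`η_pos`, `δkit_le_δ`, …) feed `hR₁_R/hRex_R` directly; this records `η ≤ δkit/2`-type uses. [folklore] -/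
theorem hR₁_U_η (hC : Φ.CylSubcritical q) (o : Bool) (c : V) :
    ∀ ρ R', (SU ex mx κ Φ t p D g f q).Rex ρ ≤ R' → ∀ (Rw : ℕ) (D' A' : Finset V), (∀ d ∈ D', d ∈ graphBall G c Rw) →
      (∀ d ∈ D', ∀ d' ∈ D', oriφ Φ.φ o d - oriφ Φ.φ o d' ∈ box 2 (mR κ Φ t p D g f (mx κ Φ t p D g f))) → A' ⊆ D' → (∀ a ∈ A', a ∈ graphBall G c (ρ + 1)) →
        (bondPercolation G q).real (excess G c R' D' A') ≤ Neg.η κ Φ :=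
  hR₁_U κ Φ t p D g f ex mx q hC o le_rfl c

end Facts

section Root

variable (κ : Consts) {V : Type} [DecidableEq V] [Countable V] {G : SimpleGraph V} [G.LocallyFinite] (Φ : PlanarSkeletonNeg G) (t : V)
  (p : unitInterval) (D : DataN V) (g f : ℕ) (ex mx : GSlot) (q : unitInterval)

/-! ## §4 `E₀` at the value, unfolded -/

/-- **`E₀ (SU …) = ex + Rex κ Φ mR q (2·ψπ) + 69·rmax′ + 4·ψπ + 48`** (`rmax′ := max fcells.rmax (cOff+1)`; `L_A = 24rmax′ + 2ψπ + Rex(2ψπ) + 36`,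
`L′ = L_A + ψπ + 12 + ex`, `E₀ = L′ + 45rmax′ + ψπ`). [folklore] -/
theorem E₀_SU_eq : Skelφ.Prm.E₀ (SU ex mx κ Φ t p D g f q) =
    ex κ Φ t p D g f + Rex κ Φ (mR κ Φ t p D g f (mx κ Φ t p D g f)) q (2 * ψπ Φ p D) + 69 * max (fcells κ Φ t p D g f).rmax (cOff κ Φ t p D g f + 1) + 4 * ψπ Φ p D + 48 := by
  show Skelφ.Prm.Lp _ + 45 * max (fcells κ Φ t p D g f).rmax (cOff κ Φ t p D g f + 1) + ψπ Φ p D = _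
  unfold Skelφ.Prm.Lp Skelφ.Prm.LA Skelφ.Prm.dL
  show 24 * max (fcells κ Φ t p D g f).rmax (cOff κ Φ t p D g f + 1) + 2 * (0 + ψπ Φ p D) + Rex κ Φ (mR κ Φ t p D g f (mx κ Φ t p D g f)) q (2 * ψπ Φ p D) +
      (24 * 1 + 8 * 0 + 12) + 0 + ψπ Φ p D + 12 * 1 + 2 * 0 + ex κ Φ t p D g f + 45 * max (fcells κ Φ t p D g f).rmax (cOff κ Φ t p D g f + 1) + ψπ Φ p D = _
  ring

/-- `L′ (SU …) = ex + Rex(2ψπ) + 24·rmax′ + 3·ψπ + 48`. [folklore] -/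
theorem Lp_SU_eq : Skelφ.Prm.Lp (SU ex mx κ Φ t p D g f q) =
    ex κ Φ t p D g f + Rex κ Φ (mR κ Φ t p D g f (mx κ Φ t p D g f)) q (2 * ψπ Φ p D) + 24 * max (fcells κ Φ t p D g f).rmax (cOff κ Φ t p D g f + 1) + 3 * ψπ Φ p D + 48 := by
  unfold Skelφ.Prm.Lp Skelφ.Prm.LA Skelφ.Prm.dL
  show 24 * max (fcells κ Φ t p D g f).rmax (cOff κ Φ t p D g f + 1) + 2 * (0 + ψπ Φ p D) + Rex κ Φ (mR κ Φ t p D g f (mx κ Φ t p D g f)) q (2 * ψπ Φ p D) +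
      (24 * 1 + 8 * 0 + 12) + 0 + ψπ Φ p D + 12 * 1 + 2 * 0 + ex κ Φ t p D g f = _
  ring

end Root

/-! ## §5 The root radius of record `Rπ := E₀ − 1` (any fibre block) and the four root radii -/

section RootRadii

variable (κ : Consts) {V : Type} [DecidableEq V] [Countable V] {G : SimpleGraph V} [G.LocallyFinite] (Φ : PlanarSkeletonNeg G) (t : V)
  (p : unitInterval) (D : DataN V) (g f : ℕ) (Sv : SSlot) (q : unitInterval)

/-- **THE ROOT RADIUS OF RECORD** `Rπ := E₀ (Sv … q) − 1` (p3-g9's slot `Rπ` of `rootOblTWAt_negBS_x/_y`; bound under `AtQO O q`, so it may read `q`). [this work] -/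
def Rπ : ℕ := Skelφ.Prm.E₀ (Sv κ Φ t p D g f q) - 1

/-- `12 ≤ E₀ S` for every block (`dL ≥ 12`). [folklore] -/
theorem twelve_le_E₀ (S : Skelφ.Prm.SchedIn) : 12 ≤ Skelφ.Prm.E₀ S := by
  unfold Skelφ.Prm.E₀ Skelφ.Prm.Lp Skelφ.Prm.LA Skelφ.Prm.dL; omega

/-- `Rπ + 1 = E₀`. [folklore] -/
theorem Rπ_succ : Rπ κ Φ t p D g f Sv q + 1 = Skelφ.Prm.E₀ (Sv κ Φ t p D g f q) := by
  have := twelve_le_E₀ (Sv κ Φ t p D g f q); unfold Rπ; omega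

/-- **`hRQ`**: `Rπ + 1 ≤ rQ 0 0` (`rQ 0 0 = E (nQ 0 0) ⊔ … ≥ E₀`). [folklore] -/
theorem hRQ_R : Rπ κ Φ t p D g f Sv q + 1 ≤ (schedOf κ Φ t p D g f (Sv κ Φ t p D g f q)).rQ 0 0 := by
  rw [Rπ_succ]
  show _ ≤ max (Erad (Skelφ.Prm.gap (Sv κ Φ t p D g f q)) (fun _ => 0) (Skelφ.Prm.E₀ (Sv κ Φ t p D g f q)) (nQ 0 0)) _
  exact le_trans (Skel.E₀_le_Erad _ _ _ _) (le_max_left _ _)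

/-- **`hRB`**: `Rπ + 1 ≤ rB 0 0 du` (`= E (nQ 0 (0+du))`). [folklore] -/
theorem hRB_R (du : MDir) : Rπ κ Φ t p D g f Sv q + 1 ≤ (schedOf κ Φ t p D g f (Sv κ Φ t p D g f q)).rB 0 0 du := by
  rw [Rπ_succ]
  show _ ≤ Erad (Skelφ.Prm.gap (Sv κ Φ t p D g f q)) (fun _ => 0) (Skelφ.Prm.E₀ (Sv κ Φ t p D g f q)) (nQ 0 (0 + stepVec du))
  exact Skel.E₀_le_Erad _ _ _ _

/-- **`hRQ′`**: `Rπ + 1 ≤ rQ 0 (0 + du)`. [folklore] -/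
theorem hRQ'_R (du : MDir) : Rπ κ Φ t p D g f Sv q + 1 ≤ (schedOf κ Φ t p D g f (Sv κ Φ t p D g f q)).rQ 0 ((0 : Site 2) + stepVec du) := by
  rw [Rπ_succ]
  show _ ≤ max (Erad (Skelφ.Prm.gap (Sv κ Φ t p D g f q)) (fun _ => 0) (Skelφ.Prm.E₀ (Sv κ Φ t p D g f q)) (nQ 0 ((0 : Site 2) + stepVec du))) _
  exact le_trans (Skel.E₀_le_Erad _ _ _ _) (le_max_left _ _)

/-- **`hRM`**: `Rπ + 1 ≤ rM 0 (0 + du)` (`rM 0 (0+du) = F 1 − L′ = E₀ + gap E₀ − L′ ≥ E₀` since `L′ ≤ gap`). [folklore] -/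
theorem hRM_R (du : MDir) : Rπ κ Φ t p D g f Sv q + 1 ≤ (schedOf κ Φ t p D g f (Sv κ Φ t p D g f q)).rM 0 ((0 : Site 2) + stepVec du) := by
  rw [Rπ_succ]
  show _ ≤ Frad (Skelφ.Prm.gap (Sv κ Φ t p D g f q)) (fun _ => 0) (Skelφ.Prm.E₀ (Sv κ Φ t p D g f q)) (nQ 0 ((0 : Site 2) + stepVec du)) - Skelφ.Prm.Lp (Sv κ Φ t p D g f q)
  rw [Skel.nQ_zero_stepVec, BoxProdZ2.Frad_succ, BoxProdZ2.Erad_zero]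
  have h := Skelφ.Prm.hgapL (Sv κ Φ t p D g f q) (Skelφ.Prm.E₀ (Sv κ Φ t p D g f q))
  omega

/-- `X + 1 ≤ E₀ → X ≤ Rπ`. [folklore] -/
theorem le_Rπ_of {X : ℕ} (h : X + 1 ≤ Skelφ.Prm.E₀ (Sv κ Φ t p D g f q)) : X ≤ Rπ κ Φ t p D g f Sv q := by
  unfold Rπ; omega

/-- `X + 1 ≤ reachK → X ≤ Rπ` (`reachK ≤ L′ ≤ E₀`). [folklore] -/
theorem le_Rπ_of_reachK {X : ℕ} (h : X + 1 ≤ (Sv κ Φ t p D g f q).reachK) : X ≤ Rπ κ Φ t p D g f Sv q :=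
  le_Rπ_of κ Φ t p D g f Sv q (le_trans h (le_trans (Skelφ.Prm.reachK_le_Lp _) (Skelφ.Prm.Lp_le_E₀ _)))

end RootRadii

/-! ## §6 The `Rπ`-inequalities of the root residue at `SU`, as floors on `ex` -/

section RootSU

variable (κ : Consts) {V : Type} [DecidableEq V] [Countable V] {G : SimpleGraph V} [G.LocallyFinite] (Φ : PlanarSkeletonNeg G) (t : V)
  (p : unitInterval) (D : DataN V) (g f : ℕ) (ex mx : GSlot) (q : unitInterval)

/-- **`X + 1 ≤ ex → X ≤ Rπ`** (p3's `hRlπ hπ1 hπ2 hRb₀ hRr₀ hRbπ`: each a floor on `ex`). [folklore] -/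
theorem ex_le_Rπ {X : ℕ} (h : X + 1 ≤ ex κ Φ t p D g f) : X ≤ Rπ κ Φ t p D g f (SU ex mx) q :=
  le_Rπ_of_reachK κ Φ t p D g f (SU ex mx) q h

/-- **`hρπ`**: `fatRadius Φ.frame hC D.k ≤ Rπ` (`ψπ + 1 ≤ E₀`). [folklore] -/
theorem fat_le_Rπ (hC : Φ.CylSubcritical p) : Skelφ.fatRadius Φ.frame hC D.k ≤ Rπ κ Φ t p D g f (SU ex mx) q := by
  refine le_Rπ_of κ Φ t p D g f (SU ex mx) q ?_
  rw [← ψπ_eq Φ hC D, E₀_SU_eq]; omega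

/-- **`hR₁b/hR₁r`**: `r₀ + 1 ≤ ex → Rex κ Φ mR q (fatRadius Φ.frame hC D.k) ≤ Rπ − r₀` (`Rex` monotone in the depth, `fatRadius k ≤ 2ψπ`, `Rex(2ψπ) + ex − 1 ≤ E₀ − 1`).
[cite: KozmaNitzan2024, §4 Lemma 12 (p. 24)] -/
theorem Rex_fat_le_Rπ_sub (hC : Φ.CylSubcritical p) {r₀ : ℕ} (h : r₀ + 1 ≤ ex κ Φ t p D g f) :
    Rex κ Φ (mR κ Φ t p D g f (mx κ Φ t p D g f)) q (Skelφ.fatRadius Φ.frame hC D.k) ≤ Rπ κ Φ t p D g f (SU ex mx) q - r₀ := by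
  have h1 : Rex κ Φ (mR κ Φ t p D g f (mx κ Φ t p D g f)) q (Skelφ.fatRadius Φ.frame hC D.k) ≤ Rex κ Φ (mR κ Φ t p D g f (mx κ Φ t p D g f)) q (2 * ψπ Φ p D) :=
    Rex_mono κ Φ _ q (by rw [ψπ_eq Φ hC D]; omega)
  have h2 := Rπ_succ κ Φ t p D g f (SU ex mx) q
  rw [E₀_SU_eq] at h2
  omega

/-- The same with the schedule's own `Rex` field (`(SU …).Rex = Rex κ Φ mR q`). [folklore] -/
theorem SRex_fat_le_Rπ_sub (hC : Φ.CylSubcritical p) {r₀ : ℕ} (h : r₀ + 1 ≤ ex κ Φ t p D g f) :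
    (SU ex mx κ Φ t p D g f q).Rex (Skelφ.fatRadius Φ.frame hC D.k) ≤ Rπ κ Φ t p D g f (SU ex mx) q - r₀ :=
  Rex_fat_le_Rπ_sub κ Φ t p D g f ex mx q hC h

end RootSU

end NegB

end PlanarSkeletonNeg

end Summit.CriticalPhenomena.PercolationContinuityZ3.Theorems.Transplant
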